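import Mathlib
import HarnessLib
import Summits.AtomisticToContinuum.HydrodynamicLimit.Theorems.RelayRaceLocalityConeLocalisationElevatorDefs
import Summits.AtomisticToContinuum.HydrodynamicLimit.Theorems.RelayRaceLocalityConeLocalisationStubTransfer
import Summits.AtomisticToContinuum.HydrodynamicLimit.Theorems.RestartPrinciple.Negative.ConsequentImpAntecedent
import Summits.AtomisticToContinuum.HydrodynamicLimit.Theorems.RelayRaceLocalityLightConeInLawSketchLine
import Summits.AtomisticToContinuum.HydrodynamicLimit.Theorems.ImplosionDichotomyHydroLimitInBandEquilibrium
import Literature.MathematicalPhysics.KineticTheory.HardSphereEulerProofs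
import Literature.MathematicalPhysics.KineticTheory.HardSphereCanonicalTorus
import Literature.MathematicalPhysics.KineticTheory.HardSphereEulerSolutionGluing

/-!
# RelayRaceLocality · ConeLocalisation — line `einstein-elevator`: the foreign stub restricted to the conjunct family (definitions + sanity)

Support file for the crux item `stmt-AtomisticToContinuum-12504` (`ConeLocalisation`, route RelayRaceLocality of
`AtomisticToContinuum/HydrodynamicLimit`), line lead a1 (prover-line-stmt-AtomisticToContinuum-12504-a1-0, 2026-08-17),
written after the adversarial audit of the line's foreign stub `Elevator.ElevatorOrbitHL` (skeleton v1, p143529) by a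
stub-worker of the lead (`Cruxes/ConeLocalisation/Lines/EinsteinElevatorSketch-audit.md`). The audit's finding, kernel-checked here:
the GENERAL-FAMILY clause of `ElevatorOrbitHL` is the only part of it that is not implied by the summit conjunct, and the
line does not use it. Hence the RESHAPED foreign stub of skeleton v2:

* `Elevator.ElevatorOrbitHLConj` — `ElevatorOrbitHL` restricted to the conjunct's own family `(hsDiameter σ N, N + 1)`
  (laws `localGibbsLaw σ a₀ u₀ θ₀ N (Φ N)`, the two LLNs spelled `TendstoHydroFieldsAt`, no probability clause);
* `Elevator.stub_elevatorOrbitHLConj_of_hydrodynamicLimit : _root_.HydrodynamicLimit → ElevatorOrbitHLConj` (anchor stub,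
  registered on the item) — the reshaped foreign stub is a NECESSARY condition of the summit conjunct `G`, for every level,
  horizon, `K`, `δ` and scale (only the packing clause on `[0, t]` is used, via `RestartPrincipleNegative.exists_packing_extension`
  and `IsHardSphereEulerSolution.restrict`); so, like `S` itself, it cannot be refuted below summit level;
* `Elevator.elevatorOrbitHLConj_of_elevatorOrbitHL : ElevatorOrbitHL → ElevatorOrbitHLConj` (specialisation;
  `isProbabilityMeasure_localGibbsLaw` at `σ ≤ 1/2`);
* `Elevator.elevatorOrbitHL_of_hydroLimitGeneral : (HL-gen) → ElevatorOrbitHL` — the full statement is dominated by the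
  packing-guarded hydrodynamic limit for general families (verbatim the hypothesis of the tree's
  `LightConeInLawSketch.DoD.lightConeInLaw_of_hydroLimitGeneral`), exactly like `LightConeInLaw` and `NearConstantShortTimeHL`;
* `Elevator.elevatorOrbitHLConj_inner_const` — the one computable instance (constant profiles: homogeneous Gibbs laws are
  invariant, dilute classical solutions unique; tree `HydroLimitInBandEquilibrium.hydroLimitInBand_inner_const`) is TRUE for
  every `M, Θ, K ≥ 1, δ > 0, ℓ₀`;
* degenerate instances: `not_guardAtScale_of_lt_one` (`M < 1` vacuous), `Ico_min_eq_empty_of_nonpos'` (`T ≤ 0`),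
  `scale_le_quarter` (`ℓ₀ ≤ 1/4`, `Θ ℓ₀ ≤ Θ/(4K)`).

The transfer from the reshaped stub, `stub_transfer_conj : ElevatorOrbitHLConj → DynamicNearAtmosphere → ShortTimeGuardedHL`,
and the unconditional certificate `ElevatorOrbitHLConj → ConeLocalisation` are in `…StubTransferConj.lean`.
-/

noncomputable section

namespace Summit.AtomisticToContinuum.HydrodynamicLimit.Theorems.ConeLocalisation.Elevator

open scoped Topology
open Filter Set MeasureTheory
open Literature.MathematicalPhysics.KineticTheory Literature.Analysis.FluidPDE
  Literature.Analysis.FunctionSpaces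
open Summit.AtomisticToContinuum.HydrodynamicLimit.Theses.RelayRaceLocality
open Summit.AtomisticToContinuum.HydrodynamicLimit.Theorems.RestartPrincipleNegative
  (exists_packing_extension)
open Summit.AtomisticToContinuum.HydrodynamicLimit.Theorems.LightConeInLawSketch (G3 LLNAt)
open Summit.AtomisticToContinuum.HydrodynamicLimit.Theorems.HydroLimitInBandEquilibrium
  (hydroLimitInBand_inner_const)

/-- **`ElevatorOrbitHL` restricted to the conjunct's own family** `(hsDiameter σ N, N + 1)`: verbatim
`ElevatorOrbitHL` with the family block `∀ (ε n), … → ∀ Φ : HardSphereFlow _ (ε N) (n N), let P := …;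
(∀ N, IsProbabilityMeasure (P N)) → LLN₀ → …` replaced by the conjunct's flows and laws
`localGibbsLaw σ a₀ u₀ θ₀ N (Φ N)` (which ARE probability measures for `σ ≤ 1/2`), the two LLNs spelled
`TendstoHydroFieldsAt` (definitionally the inline clauses). [folklore] -/
@[conjecture] def ElevatorOrbitHLConj : Prop :=
  ∃ η₀ : ℝ, 0 < η₀ ∧ ∀ M : ℝ, 0 < M → ∀ Θ : ℝ, 0 < Θ → ∃ K : ℝ, 1 ≤ K ∧ ∃ δ : ℝ, 0 < δ ∧
    ∀ (a₀ θ₀ : T3 → ℝ) (u₀ : T3 → V3), Continuous a₀ → Continuous θ₀ → Continuous u₀ →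
      (∀ x, 0 < a₀ x) → (∀ x, 0 < θ₀ x) →
    ∃ σ₀ : ℝ, 0 < σ₀ ∧ ∀ σ : ℝ, 0 < σ → σ < σ₀ →
    ∀ (T : ℝ) (ρ θ : ℝ → T3 → ℝ) (u : ℝ → T3 → V3), IsHardSphereEulerSolution σ T ρ u θ →
    ∀ ℓ₀ : ℝ, 0 < ℓ₀ → K * ℓ₀ ≤ 1 / 4 →
    (∀ x₀ : T3, ∃ g : V3, ‖g‖ * ℓ₀ ≤ 1 ∧ NearAtmosphereOn (ρ 0) (θ 0) (u 0) x₀ g (K * ℓ₀) δ) →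
    ∀ Φ : (N : ℕ) → HardSphereFlow (Torus.geometry (Fin 3)) (hsDiameter σ N) (N + 1),
    TendstoHydroFieldsAt (fun N => localGibbsLaw σ a₀ u₀ θ₀ N (Φ N)) Φ ρ u θ 0 →
    ∀ t ∈ Set.Ico 0 (min T (Θ * ℓ₀)), (∀ s ∈ Set.Icc 0 t, ∀ x, GuardAtScale η₀ M ℓ₀ σ ρ θ u s x) →
    TendstoHydroFieldsAt (fun N => localGibbsLaw σ a₀ u₀ θ₀ N (Φ N)) Φ ρ u θ t

/-- **Specialisation**: the full foreign stub implies its conjunct-family restriction (`σ₀ := min σ₀ (1/2)`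
so that the local Gibbs laws are probability measures). [folklore] -/
theorem elevatorOrbitHLConj_of_elevatorOrbitHL (h : ElevatorOrbitHL) : ElevatorOrbitHLConj := by
  obtain ⟨η₀, hη₀, H⟩ := h
  refine ⟨η₀, hη₀, fun M hM Θ hΘ => ?_⟩
  obtain ⟨K, hK, δ, hδ, H1⟩ := H M hM Θ hΘ
  refine ⟨K, hK, δ, hδ, fun a₀ θ₀ u₀ ha hθ hu ha0 hθ0 => ?_⟩
  obtain ⟨σ₀, hσ₀, H2⟩ := H1 a₀ θ₀ u₀ ha hθ hu ha0 hθ0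
  refine ⟨min σ₀ (1 / 2), lt_min hσ₀ (by norm_num), ?_⟩
  intro σ hσ hσlt T ρ θ u hsol ℓ₀ hℓ₀ hKℓ₀ hnear Φ h0 t ht hguard
  have hσ₀' : σ < σ₀ := lt_of_lt_of_le hσlt (min_le_left _ _)
  have hσhalf : σ ≤ 1 / 2 := (lt_of_lt_of_le hσlt (min_le_right _ _)).le
  have H3 := H2 σ hσ hσ₀' (hsDiameter σ) (fun N => N + 1) (fun N => hsDiameter_pos hσ N)
    (tendsto_hsDiameter σ) (tendsto_succ_mul_hsDiameter_pow_three σ) T ρ θ u hsol ℓ₀ hℓ₀ hKℓ₀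
    hnear Φ
  have hP : ∀ N, IsProbabilityMeasure (localGibbsLaw σ a₀ u₀ θ₀ N (Φ N)) := fun N =>
    isProbabilityMeasure_localGibbsLaw ha hθ hu ha0 hθ0 hσhalf N (Φ N)
  exact H3 hP h0 t ht hguard

/-- **The summit conjunct implies the conjunct-family restriction of the foreign stub**, for every level,
horizon, `K`, `δ` and scale: `G`'s `η₀` and per-profile `σ₀`; of the hypotheses only the packing clause
`ρ σ³ < η₀` of `GuardAtScale` on `[0, t]` is used — extended to a half-open `[0, T')`, `T' > t`
(`exists_packing_extension`), on which the restricted classical solution satisfies `G`'s guard. [folklore] -/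
theorem stub_elevatorOrbitHLConj_of_hydrodynamicLimit : _root_.HydrodynamicLimit → ElevatorOrbitHLConj := by
  intro hG
  obtain ⟨η₀, hη₀, hG⟩ := hG
  refine ⟨η₀, hη₀, fun M _ Θ _ => ⟨1, le_rfl, 1, one_pos, fun a₀ θ₀ u₀ ha hθ hu ha0 hθ0 => ?_⟩⟩
  obtain ⟨σ₀, hσ₀, hG⟩ := hG a₀ θ₀ u₀ ha hθ hu ha0 hθ0
  refine ⟨σ₀, hσ₀, fun σ hσ hσσ₀ T ρ θ u hsol ℓ₀ _ _ _ Φ h0 t ht hguard => ?_⟩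
  have htT : t ∈ Ico 0 T := ⟨ht.1, lt_of_lt_of_le ht.2 (min_le_left _ _)⟩
  obtain ⟨T', htT', hT'T, hpack⟩ :=
    exists_packing_extension hsol htT (fun s hs x => (hguard s hs x).1) hσ
  exact hG σ hσ hσσ₀ T' ρ θ u (hsol.restrict hT'T) hpack Φ h0 t ⟨ht.1, htT'⟩

/-- `G → EOHL♮` (named form of the anchor stub `stub_elevatorOrbitHLConj_of_hydrodynamicLimit`). [folklore] -/
theorem elevatorOrbitHLConj_of_hydrodynamicLimit (hG : _root_.HydrodynamicLimit) : ElevatorOrbitHLConj :=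
  stub_elevatorOrbitHLConj_of_hydrodynamicLimit hG

/-- **(HL-gen) ⇒ `ElevatorOrbitHL`.** The packing-guarded hydrodynamic limit for GENERAL families
`(ε N, n N)`, `n N · (ε N)³ → σ³`, `ε N → 0` — verbatim the hypothesis of the tree's
`LightConeInLawSketch.DoD.lightConeInLaw_of_hydroLimitGeneral` and
`LightConeInLawSketch.Dominance.nearConstantShortTimeHL_of_hydroLimitGeneral` — implies the full foreign
stub: take the same `η₀`, `K := 1`, `δ := 1`, the same `σ₀`, and discard nearness, the non-packing guards
and the horizon. [folklore] -/
theorem elevatorOrbitHL_of_hydroLimitGeneral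
    (hHL : ∃ η₁ : ℝ, 0 < η₁ ∧
      ∀ (a θ : T3 → ℝ) (u : T3 → V3), Continuous a → Continuous θ → Continuous u →
        (∀ x, 0 < a x) → (∀ x, 0 < θ x) →
      ∃ σ₀ : ℝ, 0 < σ₀ ∧ ∀ σ : ℝ, 0 < σ → σ < σ₀ →
      ∀ (ε : ℕ → ℝ) (n : ℕ → ℕ), (∀ N, 0 < ε N) → Tendsto ε atTop (𝓝 0) →
        Tendsto (fun N => (n N : ℝ) * ε N ^ 3) atTop (𝓝 (σ ^ 3)) →
      ∀ (T : ℝ) (ρ Θ : ℝ → T3 → ℝ) (U : ℝ → T3 → V3), IsHardSphereEulerSolution σ T ρ U Θ →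
      ∀ Φ : (N : ℕ) → HardSphereFlow G3 (ε N) (n N),
      (∀ N, IsProbabilityMeasure
        (particleLaw (Φ N) (canonicalDensity G3 (ε N) (n N) (localGibbsProfile a u θ)))) →
      LLNAt n (fun N => particleLaw (Φ N)
        (canonicalDensity G3 (ε N) (n N) (localGibbsProfile a u θ))) Φ (ρ 0) (U 0) (Θ 0) 0 →
      ∀ t : ℝ, 0 ≤ t → t < T → (∀ s ∈ Set.Icc 0 t, ∀ x, ρ s x * σ ^ 3 < η₁) →
      LLNAt n (fun N => particleLaw (Φ N)
        (canonicalDensity G3 (ε N) (n N) (localGibbsProfile a u θ))) Φ (ρ t) (U t) (Θ t) t) :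
    ElevatorOrbitHL := by
  obtain ⟨η₁, hη₁, H⟩ := hHL
  refine ⟨η₁, hη₁, fun M _ Θ _ => ⟨1, le_rfl, 1, one_pos, fun a₀ θ₀ u₀ ha hθ hu ha0 hθ0 => ?_⟩⟩
  obtain ⟨σ₀, hσ₀, Hσ⟩ := H a₀ θ₀ u₀ ha hθ hu ha0 hθ0
  refine ⟨σ₀, hσ₀, ?_⟩
  intro σ hσ hσlt ε n hε hε0 hn T ρ θ u hsol ℓ₀ _ _ _ Φ P hP hL0 t ht hguard
  exact Hσ σ hσ hσlt ε n hε hε0 hn T ρ θ u hsol Φ hP hL0 t ht.1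
    (ht.2.trans_le (min_le_left _ _)) fun s hs x => (hguard s hs x).1

/-- **The equilibrium instance is a theorem.** For CONSTANT profiles `(a, uc, θc)` the inner statement of
`ElevatorOrbitHLConj` holds for EVERY level `M`, horizon `Θ`, `K ≥ 1`, `δ > 0` and scale `ℓ₀` (in fact for
every classical solution tied at `t = 0` to the homogeneous local Gibbs laws, whatever its nearness): the
homogeneous Gibbs law is invariant under every hard-sphere flow and dilute classical solutions are unique,
`HydroLimitInBandEquilibrium.hydroLimitInBand_inner_const` (packing band `η₁` from the analytic equation
of state, a tree theorem), transported through the packing extension exactly as in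
`elevatorOrbitHLConj_of_hydrodynamicLimit`. So the ONE instance of the foreign stub whose time-`t` law is
computable from tree facts is TRUE: no refutation by conservation laws or invariant measures. [folklore] -/
theorem elevatorOrbitHLConj_inner_const :
    ∃ η₀ : ℝ, 0 < η₀ ∧ ∀ M : ℝ, 0 < M → ∀ Θ : ℝ, 0 < Θ → ∀ K : ℝ, 1 ≤ K → ∀ δ : ℝ, 0 < δ →
    ∀ (a θc : ℝ) (uc : V3), 0 < a → 0 < θc →
    ∃ σ₀ : ℝ, 0 < σ₀ ∧ ∀ σ : ℝ, 0 < σ → σ < σ₀ →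
    ∀ (T : ℝ) (ρ θ : ℝ → T3 → ℝ) (u : ℝ → T3 → V3), IsHardSphereEulerSolution σ T ρ u θ →
    ∀ ℓ₀ : ℝ, 0 < ℓ₀ → K * ℓ₀ ≤ 1 / 4 →
    (∀ x₀ : T3, ∃ g : V3, ‖g‖ * ℓ₀ ≤ 1 ∧ NearAtmosphereOn (ρ 0) (θ 0) (u 0) x₀ g (K * ℓ₀) δ) →
    ∀ Φ : (N : ℕ) → HardSphereFlow (Torus.geometry (Fin 3)) (hsDiameter σ N) (N + 1),
    TendstoHydroFieldsAt
      (fun N => localGibbsLaw σ (fun _ => a) (fun _ => uc) (fun _ => θc) N (Φ N)) Φ ρ u θ 0 →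
    ∀ t ∈ Set.Ico 0 (min T (Θ * ℓ₀)), (∀ s ∈ Set.Icc 0 t, ∀ x, GuardAtScale η₀ M ℓ₀ σ ρ θ u s x) →
    TendstoHydroFieldsAt
      (fun N => localGibbsLaw σ (fun _ => a) (fun _ => uc) (fun _ => θc) N (Φ N)) Φ ρ u θ t := by
  obtain ⟨η₁, hη₁, H⟩ := hydroLimitInBand_inner_const
  refine ⟨η₁, hη₁, fun M _ Θ _ K _ δ _ a θc uc ha hθc => ?_⟩
  obtain ⟨σ₀, hσ₀, H1⟩ := H a θc uc ha hθc
  refine ⟨σ₀, hσ₀, fun σ hσ hσσ₀ T ρ θ u hsol ℓ₀ _ _ _ Φ h0 t ht hguard => ?_⟩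
  have htT : t ∈ Ico 0 T := ⟨ht.1, lt_of_lt_of_le ht.2 (min_le_left _ _)⟩
  obtain ⟨T', htT', hT'T, hpack⟩ :=
    exists_packing_extension hsol htT (fun s hs x => (hguard s hs x).1) hσ
  exact H1 σ hσ hσσ₀ T' ρ θ u (hsol.restrict hT'T) hpack Φ h0 t ⟨ht.1, htT'⟩

/-! ## Degenerate instances (all vacuous-true, never false) -/

/-- For `0 < M < 1` the scale-covariant guards are unsatisfiable (`θ ≤ M < 1 < M⁻¹ ≤ θ`): the `M < 1`
clauses of `ElevatorOrbitHL` hold vacuously (the guard hypothesis at `s = 0` fails). [folklore] -/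
theorem not_guardAtScale_of_lt_one {η M ℓ σ : ℝ} {ρ θ : ℝ → T3 → ℝ} {u : ℝ → T3 → V3} {s : ℝ}
    {x : T3} (hM : 0 < M) (hM1 : M < 1) : ¬ GuardAtScale η M ℓ σ ρ θ u s x := by
  rintro ⟨-, -, h3, h4, -⟩
  have : (1 : ℝ) < M⁻¹ := one_lt_inv_iff₀.2 ⟨hM, hM1⟩
  linarith

/-- `T ≤ 0` (degenerate classical horizon) empties the time range `Ico 0 (min T (Θ ℓ₀))` of the
conclusion, whatever `Θ, ℓ₀`. [folklore] -/
theorem Ico_min_eq_empty_of_nonpos' {T a : ℝ} (hT : T ≤ 0) : Set.Ico 0 (min T a) = ∅ :=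
  Set.Ico_eq_empty (not_lt.2 ((min_le_left _ _).trans hT))

/-- The admissible scales are short: `K ℓ₀ ≤ 1/4` with `K ≥ 1` forces `ℓ₀ ≤ 1/4` (so the minimal-image
chart of `NearAtmosphereOn`, valid for radii `< 1/2`, is never left) and the horizon obeys
`Θ ℓ₀ ≤ Θ / (4 K)` — `K` being chosen after `Θ`, "for every natural horizon `Θ`" is not a long-time
claim. [folklore] -/
theorem scale_le_quarter {K ℓ₀ Θ : ℝ} (hK : 1 ≤ K) (hℓ₀ : 0 < ℓ₀) (hKℓ₀ : K * ℓ₀ ≤ 1 / 4)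
    (hΘ : 0 ≤ Θ) : ℓ₀ ≤ 1 / 4 ∧ Θ * ℓ₀ ≤ Θ / (4 * K) := by
  have hK0 : 0 < K := by linarith
  refine ⟨?_, ?_⟩
  · have : ℓ₀ ≤ K * ℓ₀ := le_mul_of_one_le_left hℓ₀.le hK
    linarith
  · rw [le_div_iff₀ (by positivity)]
    nlinarith

end Summit.AtomisticToContinuum.HydrodynamicLimit.Theorems.ConeLocalisation.Elevator

end
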